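import Summits.BirchSwinnertonDyer.BirchSwinnertonDyer.Theorems.Rank2ObservatoryRank2Table
import Summits.BirchSwinnertonDyer.BirchSwinnertonDyer.Theorems.Rank2ObservatoryRank2Decade0
import Summits.BirchSwinnertonDyer.BirchSwinnertonDyer.Theorems.Rank2ObservatoryRank2Decade1
import Summits.BirchSwinnertonDyer.BirchSwinnertonDyer.Theorems.Rank2ObservatoryRank2Decade2
import Summits.BirchSwinnertonDyer.BirchSwinnertonDyer.Theorems.Rank2ObservatoryRank2Decade3
import Summits.BirchSwinnertonDyer.BirchSwinnertonDyer.Theorems.Rank2ObservatoryRank2Decade4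
import Summits.BirchSwinnertonDyer.BirchSwinnertonDyer.Theorems.Rank2ObservatoryRank2Decade5
import Summits.BirchSwinnertonDyer.BirchSwinnertonDyer.Theorems.Rank2ObservatoryRank2Decade6
import Summits.BirchSwinnertonDyer.BirchSwinnertonDyer.Theorems.Rank2ObservatoryRank2Decade7
import Summits.BirchSwinnertonDyer.BirchSwinnertonDyer.Theorems.Rank2ObservatoryRank2Decade8
import Summits.BirchSwinnertonDyer.BirchSwinnertonDyer.Theorems.Rank2ObservatoryRank2Decade9
import HarnessLib

/-!
# BirchSwinnertonDyer — rank ≥ 2 observatory: the rank-2 census (all 348672 curves, `N < 500 000`)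

HONEST FRAMING: per-curve certified theorems and census instruments; no claim on BSD in rank ≥ 2.

`rank2Table` is the concatenation of the ten decades `Rank2ObservatoryRank2Decade0 … 9` (decade `D` =
conductors `50 000·D ≤ N < 50 000·(D+1)`), each the concatenation of the machine-written chunks of its
ten conductor windows `NN` = `5000·NN ≤ N < 5000·NN + 5000` (`Rank2ObservatoryRank2RowsNN`, or two
half-window chunks `…RowsNNa` / `…RowsNNb` where one file would exceed the gate's 200 kB cap; 194 chunks
in all): one `Rank2Row` per curve of (algebraic = analytic) rank `2` and conductor `N < 500 000` in
Cremona's table — `348672` curves in `279056` isogeny classes, `N = 389 … 499998`, from `389a1` to `499998e1`. THEOREMS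
(kernel-checked, no `native_decide`, axioms ⊆ the gate whitelist):

* `rank2Table_check` — every row satisfies `Rank2Row.check` (assembled from the 194 chunk theorems, each
  a `decide +kernel` evaluation): `Δ ≠ 0`, the two listed generators lie on the curve and are distinct,
  `0 < N`; `rank2Table_length` — the table has `348672` rows; `rank2Table_conductor_lt` — every `N < 500 000`;
* `rank2_analyticRank_eq_rank_of_mem` — **for every curve `E` in the table, `r_an(E) = rank_ℤ E(ℚ)`**
  given, as NAMED HYPOTHESES, Gross–Zagier–Kolyvagin (`hGZK`, the tree's fact bsd.S17) and the row's
  three certificate fields `rank_lower` (`hlow : 2 ≤ rank`), `rank_upper` (`hup : rank ≤ 2`, 2-descent;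
  Selmer form `rank2_analyticRank_eq_rank_selmer_of_mem`) and `L2` (`hL2 : L″(E,1) ≠ 0`) — the
  aggregated form of the per-curve kernel facts `analyticRank_eq_rank_<label>`;
  `rank2_analyticRank_eq_two_of_mem` likewise; `rank2_analyticRank_eq_rank_of_linearIndependent_of_mem`
  takes the lower bound in its sharp form `hind : LinearIndependent ℤ ![gen₁, gen₂]` (the two LISTED
  generators independent — what the certificate's witnesses show) and derives `2 ≤ rank` by the
  Mordell–Weil theorem PROVED in the tree;
* `rank2_lvalue_eq_zero_of_mem`, `rank2_lderiv_eq_zero_of_mem` — **for every curve in the table,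
  `L(E,1) = 0` and `L′(E,1) = 0` EXACTLY**, from `hGZK` and `hlow` ALONE (route K of the certificate:
  Gross–Zagier–Kolyvagin in contrapositive; Cremona 1997 §2.13);
* lookups: `row ∈ rank2Rows<chunk>` by a kernel `decide` (derived `DecidableEq Rank2Row`), then
  `mem_rank2DecadeD_of_mem_chunk rank2Rows<chunk>_mem_decadeD`, then `mem_rank2Table_of_mem_decade
  rank2DecadeD_mem_decades` — recipe and two worked labels in `Rank2ObservatoryRank2CensusLookup.lean`.

What remains a hypothesis and why (no reduction map `E(ℚ) → Ẽ(𝔽_q)`, no 2-descent, no analytic `L″` or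
root number in Mathlib/the tree) is spelled out in `Rank2ObservatoryCertificate.lean`; the root number
`w = +1` (certificate field `root_number`, exact) is not needed for any theorem here. Completeness of
the list ("every rank-2 curve of conductor `< 500 000`") is Cremona's table (DATA, not a theorem): the
`348672` labels are exactly the rank-2 rows of ecdata `allgens.00000-09999 … 490000-499999`.

DATA (provenance; recorded, not proved). Source table `rank2_table.tsv`, sha256
`8b151c933b69ee8dae4834c21efd171353ae94c887716c05b7381d12d173f912` (cell HOME
`run/shared/lean/b2b/bsd-rank2-observatory/b2b-bsdr2-cert-1/lean-census/`, with the generator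
`gen_rank2_table.py` and `SUMMARY.json`; the generator re-checks every row with the same predicate in
Python — discriminant by two formulas, points on the curve by two formulas — and halts on any failed
cross-check: none). Columns `label, a-invariants, N, generators` = Cremona's ecdata = the fields
`conductor`, `ainvs`, `rank_lower.P1/P2` (`source_of_points = "Cremona allgens"`) of the curve's engine-P
rank-2 certificate (schema `bsdr2-cert-1/v1`; cell seat cert-1; PARI/GP 2.17 + python-flint/Arb; one
JSON per curve; all `348672` with `status = CERTIFIED`, every claim true, `root_number = +1` exact,
`ellrank` upper bound `2`; `L(E,1) = 0` certified by routes I+K: 342073, M+I+K: 6599; independence of the two listed generators modulo torsion certified by v2: 346187, v1+torsion-exact(R17): 1582, v1+torsion-exact(cert): 903 (referee R17; supplement summary.tsv sha256 0687dacbe54158e1…)). Engine-P certificate sets read (every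
file's sha256 verified against the shard's `certs.sha256.json`; the census TSV `CENSUS-rank2-engineP.tsv`
names the authoritative shard of each label):
* `B050-j064476` (farm job `j064476`): 16311 certificates read, 16311 used, `certs.sha256.json` sha256 `967d6fb68fc3d281…`, `certs.tar.gz` sha256 `848bd8baf965e5ff…`
* `B075-j064479` (farm job `j064479`): 17052 certificates read, 17052 used, `certs.sha256.json` sha256 `dc587fd201e718c2…`, `certs.tar.gz` sha256 `22fafb4309260094…`
* `B100-j064483` (farm job `j064483`): 17102 certificates read, 17102 used, `certs.sha256.json` sha256 `047d31cd23b8a294…`, `certs.tar.gz` sha256 `04183169aee0f2b2…`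
* `B125-j066201` (farm job `j066201`): 17472 certificates read, 17472 used, `certs.sha256.json` sha256 `7841ba55c8e78ab0…`, `certs.tar.gz` sha256 `e8470aacbed28f7e…`
* `B150-j066203` (farm job `j066203`): 17416 certificates read, 17416 used, `certs.sha256.json` sha256 `e636ac3cb01fd692…`, `certs.tar.gz` sha256 `d56da80b4740d13b…`
* `B175-j066204` (farm job `j066204`): 17878 certificates read, 17878 used, `certs.sha256.json` sha256 `a439878d79253d36…`, `certs.tar.gz` sha256 `50f0da9b730b27dc…`
* `B200-j066318` (farm job `j066318`): 18171 certificates read, 18171 used, `certs.sha256.json` sha256 `47f3cbf3c8d05e6d…`, `certs.tar.gz` sha256 `f2fd06852db4da3f…`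
* `B225-j066329` (farm job `j066329`): 17941 certificates read, 17941 used, `certs.sha256.json` sha256 `ed7b89080083d652…`, `certs.tar.gz` sha256 `702c84c752c1a164…`
* `B250-j066331` (farm job `j066331`): 18229 certificates read, 18229 used, `certs.sha256.json` sha256 `dccb26b8eb371757…`, `certs.tar.gz` sha256 `da97068f4339a5d6…`
* `B275-j066335` (farm job `j066335`): 18646 certificates read, 18646 used, `certs.sha256.json` sha256 `ca1b2331aa6dad37…`, `certs.tar.gz` sha256 `a9249427ca7f1f96…`
* `B300-j066336` (farm job `j066336`): 18509 certificates read, 18509 used, `certs.sha256.json` sha256 `122ac223dbb4f533…`, `certs.tar.gz` sha256 `bf2a0e3d9ecf46f4…`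
* `B325-j066337` (farm job `j066337`): 18838 certificates read, 18838 used, `certs.sha256.json` sha256 `300d4d4485865ada…`, `certs.tar.gz` sha256 `ea1feac5d10f23f8…`
* `B350-j066339` (farm job `j066339`): 18624 certificates read, 18624 used, `certs.sha256.json` sha256 `27372b02378ee37f…`, `certs.tar.gz` sha256 `c8c9bc1e4a3b4049…`
* `B375-j066340` (farm job `j066340`): 18545 certificates read, 18545 used, `certs.sha256.json` sha256 `17a31bf5635e2642…`, `certs.tar.gz` sha256 `230a48dd05b2afcb…`
* `B400-j066341` (farm job `j066341`): 18803 certificates read, 18803 used, `certs.sha256.json` sha256 `7416b13ae6c00c7a…`, `certs.tar.gz` sha256 `f9d844bb6177d3dd…`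
* `B425a-j075360` (farm job `j075360`): 13110 certificates read, 13110 used, `certs.sha256.json` sha256 `8a235e2ff3f02cad…`, `certs.tar.gz` sha256 `1af0bffcbc61b9e0…`
* `B443-j075361` (farm job `j075361`): 13130 certificates read, 13130 used, `certs.sha256.json` sha256 `7ca703be7d54658b…`, `certs.tar.gz` sha256 `e8d33ce7a5005cc5…`
* `B461-j075363` (farm job `j075363`): 14245 certificates read, 14245 used, `certs.sha256.json` sha256 `b001846ed8057b6c…`, `certs.tar.gz` sha256 `5f3002e46ee20929…`
* `B480-j075371` (farm job `j075371`): 15038 certificates read, 15038 used, `certs.sha256.json` sha256 `84ee949b8d912343…`, `certs.tar.gz` sha256 `47354311719215f6…`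
* `M01-j070638` (farm job `j070638`): 190 certificates read, 190 used, `certs.sha256.json` sha256 `fb68bd5870fbb214…`
* `M02-j070640` (farm job `j070640`): 202 certificates read, 202 used, `certs.sha256.json` sha256 `a078ee8f42b020bf…`
* `M03-j070641` (farm job `j070641`): 219 certificates read, 219 used, `certs.sha256.json` sha256 `9c72fd2136321f4e…`
* `M04-j070644` (farm job `j070644`): 200 certificates read, 200 used, `certs.sha256.json` sha256 `7dc525bba9ce8b03…`
* `M05-j070646` (farm job `j070646`): 210 certificates read, 210 used, `certs.sha256.json` sha256 `9f9f6180572f01fb…`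
* `M06-j070648` (farm job `j070648`): 211 certificates read, 211 used, `certs.sha256.json` sha256 `6372b8515d554a79…`
* `M07-j070649` (farm job `j070649`): 229 certificates read, 229 used, `certs.sha256.json` sha256 `5355516a36cec457…`
* `M08-j070650` (farm job `j070650`): 216 certificates read, 216 used, `certs.sha256.json` sha256 `528b25faf1aee11f…`
* `M09-j070652` (farm job `j070652`): 187 certificates read, 187 used, `certs.sha256.json` sha256 `0d1f43ffaac7db65…`
* `M10-j070658` (farm job `j070658`): 235 certificates read, 235 used, `certs.sha256.json` sha256 `c74359854c4b3090…`
* `M11-j070661` (farm job `j070661`): 158 certificates read, 158 used, `certs.sha256.json` sha256 `191f0dc9495fc712…`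
* `M12-j070668` (farm job `j070668`): 197 certificates read, 197 used, `certs.sha256.json` sha256 `57d061e4a7ced8b6…`
* `M13-j070670` (farm job `j070670`): 185 certificates read, 185 used, `certs.sha256.json` sha256 `1d7a51434b817e21…`
* `M14-j070671` (farm job `j070671`): 158 certificates read, 158 used, `certs.sha256.json` sha256 `0d19e0c95640244c…`
* `M15-j070672` (farm job `j070672`): 167 certificates read, 167 used, `certs.sha256.json` sha256 `b5a51231110814a7…`
* `M16-j070675` (farm job `j070675`): 200 certificates read, 200 used, `certs.sha256.json` sha256 `8486d03ed7a51295…`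
* `M17-j071329` (farm job `j071329`): 166 certificates read, 166 used, `certs.sha256.json` sha256 `b3aff4c70ec5773d…`
* `M18-j071331` (farm job `j071331`): 200 certificates read, 200 used, `certs.sha256.json` sha256 `00a272ce527ee4da…`
* `M19-j071577` (farm job `j071577`): 114 certificates read, 114 used, `certs.sha256.json` sha256 `f3e7fdfa4e490d63…`
* `S0-j063818` (farm job `j063818`): 108 certificates read, 108 used, `certs.sha256.json` sha256 `7907de5ce0b97787…`
* `S1a-j064324` (farm job `j064324`): 847 certificates read, 847 used, `certs.sha256.json` sha256 `f74dee97582af7e3…`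
* `S1b-j064557` (farm job `j064557`): 1433 certificates read, 1433 used, `certs.sha256.json` sha256 `d5b677c79f20b060…`
* `S2a1-j064563-salvaged` (farm job `j064563`): 766 certificates read, 766 used, `certs.sha256.json` sha256 `1eac9842f4689796…`
* `S3-j064419` (farm job `j064419`): 16814 certificates read, 16814 used, `certs.sha256.json` sha256 `bc94a10bf0338ab1…`, `certs.tar.gz` sha256 `17a1c0ff21d74541…`
* `pilotM2-j063829` (farm job `j063829`): 36 certificates read, 0 used, `certs.sha256.json` sha256 `d7bc6a64f8e3dd44…`
The second engine (cell seat cert-3, Python standard library only) and the per-shard two-engine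
AGREEMENT ledgers (`certs/rank2/shards/<shard>/AGREEMENT-*.tsv`: root number, `L(E,1) = 0` route, `Λ″`
ball, real period, regulator; any disagreement is an ANOMALY UNDER VERIFICATION handled by the cell's
referee, never a row here) live under the same HOME; this file makes no claim about them.

References: J. E. Cremona, *Algorithms for Modular Elliptic Curves* (2nd ed. 1997), §2.13, Ch. IV and
the tables (ecdata); B. H. Gross, D. Zagier, Invent. Math. 84 (1986), Thm. I.6.3; V. A. Kolyvagin,
Progr. Math. 87 (1990); H. Darmon, CBMS 101 (2004), Thm. 3.22 (tree fact bsd.S17); J. H. Silverman, AEC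
Thm. VIII.6.7 and X.4.2.
-/

-- single-conjunct summit: `Summit.BirchSwinnertonDyer.BirchSwinnertonDyer.…` repeats the name by design
set_option linter.dupNamespace false

noncomputable section

open scoped Classical
open scoped AddSubgroup

namespace Summit.BirchSwinnertonDyer.BirchSwinnertonDyer.Rank2Observatory

open Literature Literature.NumberTheory.EllipticCurves WeierstrassCurve

/-- The ten decades of the rank-2 census table, in conductor order. [cite: CremonaAlgorithms1997, Tables] -/
def rank2Decades : List (List Rank2Row) := [
  rank2Decade0, rank2Decade1, rank2Decade2, rank2Decade3, rank2Decade4, rank2Decade5,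
  rank2Decade6, rank2Decade7, rank2Decade8, rank2Decade9]

/-- **The rank-2 census table**: all `348672` curves of rank `2` and conductor `N < 500 000` in Cremona's
table, one `Rank2Row` each (source `rank2_table.tsv`, sha256 `8b151c933b69ee8d…`).
[cite: CremonaAlgorithms1997, Tables] -/
def rank2Table : List Rank2Row :=
  rank2Decades.flatten

/-- Every row of the census table satisfies the row predicate `Rank2Row.check` (194 chunk theorems, each
a kernel `decide`, assembled through the ten decades). [folklore] -/
theorem rank2Table_check : rank2Table.all Rank2Row.check = true := by
  simp only [rank2Table, rank2Decades, List.flatten_cons, List.flatten_nil, List.all_append,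
    List.all_nil, Bool.and_true,
    rank2Decade0_check, rank2Decade1_check, rank2Decade2_check, rank2Decade3_check,
    rank2Decade4_check, rank2Decade5_check, rank2Decade6_check, rank2Decade7_check,
    rank2Decade8_check, rank2Decade9_check]

/-- The census table has `348672` rows (sum of the kernel-counted chunk lengths).
[cite: CremonaAlgorithms1997, Tables] -/
theorem rank2Table_length : rank2Table.length = 348672 := by
  simp only [rank2Table, rank2Decades, List.flatten_cons, List.flatten_nil, List.length_append,
    List.length_nil,
    rank2Decade0_length, rank2Decade1_length, rank2Decade2_length, rank2Decade3_length,
    rank2Decade4_length, rank2Decade5_length, rank2Decade6_length, rank2Decade7_length,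
    rank2Decade8_length, rank2Decade9_length]

/-- Every conductor in the census table is `< 500 000` (from the kernel-checked chunk ranges).
[cite: CremonaAlgorithms1997, Tables] -/
theorem rank2Table_conductor_lt : rank2Table.all (fun r => decide (r.N < 500000)) = true := by
  simp only [rank2Table, rank2Decades, List.flatten_cons, List.flatten_nil, List.all_append,
    List.all_nil, Bool.and_true,
    rank2Decade0_conductor_lt, rank2Decade1_conductor_lt, rank2Decade2_conductor_lt,
    rank2Decade3_conductor_lt, rank2Decade4_conductor_lt, rank2Decade5_conductor_lt,
    rank2Decade6_conductor_lt, rank2Decade7_conductor_lt, rank2Decade8_conductor_lt,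
    rank2Decade9_conductor_lt]

/-- A row of the census table checks. [folklore] -/
theorem check_of_mem_rank2Table {r : Rank2Row} (hr : r ∈ rank2Table) : r.check = true :=
  Rank2Row.check_of_all_check rank2Table_check hr

/-- Every curve of the census table is an elliptic curve (`Δ ≠ 0`, kernel). [folklore] -/
theorem isElliptic_of_mem_rank2Table {r : Rank2Row} (hr : r ∈ rank2Table) : r.curve.IsElliptic :=
  r.toRank3Row.isElliptic_of_delta_ne_zero (r.check_spec (check_of_mem_rank2Table hr)).1

/-- Every conductor of the census table is `< 500 000`. [cite: CremonaAlgorithms1997, Tables] -/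
theorem conductor_lt_of_mem_rank2Table {r : Rank2Row} (hr : r ∈ rank2Table) : r.N < 500000 :=
  of_decide_eq_true (List.all_eq_true.mp rank2Table_conductor_lt r hr)

/-- The two listed generators of every curve of the table are distinct points of `E(ℚ)` (kernel).
[folklore] -/
theorem gen₁_ne_gen₂_of_mem_rank2Table {r : Rank2Row} (hr : r ∈ rank2Table) :
    r.gen₁ (check_of_mem_rank2Table hr) ≠ r.gen₂ (check_of_mem_rank2Table hr) :=
  r.gen₁_ne_gen₂ (check_of_mem_rank2Table hr)

/-- **Aggregated weak BSD in rank 2, census form**: for every curve `E` of conductor `< 500 000` and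
rank `2` in the table, `r_an(E) = rank_ℤ E(ℚ)` — given Gross–Zagier–Kolyvagin (`hGZK`, bsd.S17) and the
curve's certificate fields `rank_lower`, `rank_upper`, `L2` as named hypotheses
(`Rank2Row.analyticRank_eq_rank`; table hash in the module docstring).
[cite: CremonaAlgorithms1997, §2.13] [cite: Darmon2004, Thm. 3.22] -/
theorem rank2_analyticRank_eq_rank_of_mem {r : Rank2Row} (hr : r ∈ rank2Table)
    (hGZK : rank_eq_analyticRank_of_analyticRank_le_one)
    (hlow : 2 ≤ r.curve.mordellWeilRank) (hup : r.curve.mordellWeilRank ≤ 2)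
    (hL2 : iteratedDeriv 2 r.curve.entireLFunction 1 ≠ 0) :
    r.curve.analyticRank = r.curve.mordellWeilRank :=
  r.analyticRank_eq_rank (check_of_mem_rank2Table hr) hGZK hlow hup hL2

/-- Census form of `r_an(E) = 2`. [cite: CremonaAlgorithms1997, §2.13] -/
theorem rank2_analyticRank_eq_two_of_mem {r : Rank2Row} (hr : r ∈ rank2Table)
    (hGZK : rank_eq_analyticRank_of_analyticRank_le_one)
    (hlow : 2 ≤ r.curve.mordellWeilRank) (hup : r.curve.mordellWeilRank ≤ 2)
    (hL2 : iteratedDeriv 2 r.curve.entireLFunction 1 ≠ 0) :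
    r.curve.analyticRank = 2 :=
  r.analyticRank_eq_two (check_of_mem_rank2Table hr) hGZK hlow hup hL2

/-- Census form with the descent (Selmer) upper bound `#Sel^(2)(E/ℚ) ≤ 4 · #E(ℚ)[2]`.
[cite: CremonaAlgorithms1997, §2.13] [cite: SilvermanAEC2009, Thm X.4.2] -/
theorem rank2_analyticRank_eq_rank_selmer_of_mem {r : Rank2Row} (hr : r ∈ rank2Table)
    (hGZK : rank_eq_analyticRank_of_analyticRank_le_one)
    (hlow : 2 ≤ r.curve.mordellWeilRank)
    (hsel : Nat.card (r.curve.selmerGroup 2) ≤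
      2 ^ 2 * Nat.card (r.curve.toAffine.Point[(2 : ℤ)]))
    (hL2 : iteratedDeriv 2 r.curve.entireLFunction 1 ≠ 0) :
    r.curve.analyticRank = r.curve.mordellWeilRank :=
  r.analyticRank_eq_rank_selmer (check_of_mem_rank2Table hr) hGZK hlow hsel hL2

/-- Census form with the sharp lower bound: the two LISTED generators of the row are `ℤ`-linearly
independent (`hind`; certificate field `rank_lower.independent_mod_torsion`), whence `2 ≤ rank` by the
Mordell–Weil theorem proved in the tree.
[cite: CremonaAlgorithms1997, §2.13] [cite: SilvermanAEC2009, Thm. VIII.6.7] -/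
theorem rank2_analyticRank_eq_rank_of_linearIndependent_of_mem {r : Rank2Row} (hr : r ∈ rank2Table)
    (hGZK : rank_eq_analyticRank_of_analyticRank_le_one)
    (hind : LinearIndependent ℤ
      ![r.gen₁ (check_of_mem_rank2Table hr), r.gen₂ (check_of_mem_rank2Table hr)])
    (hup : r.curve.mordellWeilRank ≤ 2) (hL2 : iteratedDeriv 2 r.curve.entireLFunction 1 ≠ 0) :
    r.curve.analyticRank = r.curve.mordellWeilRank :=
  r.analyticRank_eq_rank_of_linearIndependent (check_of_mem_rank2Table hr) hGZK hind hup hL2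

/-- **Census form of the exact vanishing `L(E,1) = 0`** for every curve of the table, from
Gross–Zagier–Kolyvagin (`hGZK`) and the certified lower bound `hlow : 2 ≤ rank` alone.
[cite: CremonaAlgorithms1997, §2.13] [cite: Darmon2004, Thm. 3.22] -/
theorem rank2_lvalue_eq_zero_of_mem {r : Rank2Row} (hr : r ∈ rank2Table)
    (hGZK : rank_eq_analyticRank_of_analyticRank_le_one) (hlow : 2 ≤ r.curve.mordellWeilRank) :
    r.curve.entireLFunction 1 = 0 :=
  r.entireLFunction_one_eq_zero (check_of_mem_rank2Table hr) hGZK hlow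

/-- **Census form of the exact vanishing `L′(E,1) = 0`** for every curve of the table, from `hGZK` and
`hlow : 2 ≤ rank` alone. [cite: CremonaAlgorithms1997, §2.13] [cite: Darmon2004, Thm. 3.22] -/
theorem rank2_lderiv_eq_zero_of_mem {r : Rank2Row} (hr : r ∈ rank2Table)
    (hGZK : rank_eq_analyticRank_of_analyticRank_le_one) (hlow : 2 ≤ r.curve.mordellWeilRank) :
    deriv r.curve.entireLFunction 1 = 0 :=
  r.deriv_entireLFunction_one_eq_zero (check_of_mem_rank2Table hr) hGZK hlow

/-! ### Lookup helpers: decade membership (the per-label recipe is in `…CensusLookup.lean`) -/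

/-- A row of a decade is a row of the table. [folklore] -/
theorem mem_rank2Table_of_mem_decade {l : List Rank2Row} (hl : l ∈ rank2Decades) {r : Rank2Row}
    (hr : r ∈ l) : r ∈ rank2Table :=
  List.mem_flatten.mpr ⟨l, hl, hr⟩

/-- Decade 0 is a decade of the table. [folklore] -/
theorem rank2Decade0_mem_decades : rank2Decade0 ∈ rank2Decades :=
  List.mem_iff_getElem?.mpr ⟨0, rfl⟩

/-- Decade 1 is a decade of the table. [folklore] -/
theorem rank2Decade1_mem_decades : rank2Decade1 ∈ rank2Decades :=
  List.mem_iff_getElem?.mpr ⟨1, rfl⟩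

/-- Decade 2 is a decade of the table. [folklore] -/
theorem rank2Decade2_mem_decades : rank2Decade2 ∈ rank2Decades :=
  List.mem_iff_getElem?.mpr ⟨2, rfl⟩

/-- Decade 3 is a decade of the table. [folklore] -/
theorem rank2Decade3_mem_decades : rank2Decade3 ∈ rank2Decades :=
  List.mem_iff_getElem?.mpr ⟨3, rfl⟩

/-- Decade 4 is a decade of the table. [folklore] -/
theorem rank2Decade4_mem_decades : rank2Decade4 ∈ rank2Decades :=
  List.mem_iff_getElem?.mpr ⟨4, rfl⟩

/-- Decade 5 is a decade of the table. [folklore] -/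
theorem rank2Decade5_mem_decades : rank2Decade5 ∈ rank2Decades :=
  List.mem_iff_getElem?.mpr ⟨5, rfl⟩

/-- Decade 6 is a decade of the table. [folklore] -/
theorem rank2Decade6_mem_decades : rank2Decade6 ∈ rank2Decades :=
  List.mem_iff_getElem?.mpr ⟨6, rfl⟩

/-- Decade 7 is a decade of the table. [folklore] -/
theorem rank2Decade7_mem_decades : rank2Decade7 ∈ rank2Decades :=
  List.mem_iff_getElem?.mpr ⟨7, rfl⟩

/-- Decade 8 is a decade of the table. [folklore] -/
theorem rank2Decade8_mem_decades : rank2Decade8 ∈ rank2Decades :=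
  List.mem_iff_getElem?.mpr ⟨8, rfl⟩

/-- Decade 9 is a decade of the table. [folklore] -/
theorem rank2Decade9_mem_decades : rank2Decade9 ∈ rank2Decades :=
  List.mem_iff_getElem?.mpr ⟨9, rfl⟩

end Summit.BirchSwinnertonDyer.BirchSwinnertonDyer.Rank2Observatory

end
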